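import Summits.BirchSwinnertonDyer.BirchSwinnertonDyer.Theorems.ByReductionTypeAtTwoTorsionEulerCharMultNonsplitDoor
import Summits.BirchSwinnertonDyer.BirchSwinnertonDyer.Theorems.PublishedInputsGreenbergLemma34AtZero
import Summits.BirchSwinnertonDyer.BirchSwinnertonDyer.Theorems.PublishedInputsGreenbergLocalSurjectivityAtP
import Summits.BirchSwinnertonDyer.BirchSwinnertonDyer.Theorems.PublishedInputsGreenbergCharValueRankZeroNoTorsion
import HarnessLib

set_option linter.dupNamespace false -- `…BirchSwinnertonDyer.BirchSwinnertonDyer…` is the cell's nested layout (D-0017)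
set_option autoImplicit false

/-!
# Greenberg LNM 1716 Theorem 4.1 over `ℚ` at a GOOD ORDINARY prime WITH RATIONAL `p`-TORSION — the UPPER-HALF direction
# `f_E(0)·#E(ℚ)(p)² ∈ p^{ord_p ∏_ℓ c_ℓ} · #Ẽ(𝔽_p)(p)² · #Sel_{p^∞}(E/ℚ) · (ℤ_p ∖ {0})`, UNCONDITIONALLY (every prime `p`, `2` included)

Cell `bsd-2adic` (run/shared/lean/pub/bsd-2adic/), seat `bsd-2adic-tower-1` GEN 32; `--supports stmt-BirchSwinnertonDyer-19271`
(helper for the GOOD-ORDINARY rows at `2` WITH a rational `2`-torsion point — the 83-class α-go habitat and the Prop-5.14-silent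
reducible classes — whose upper-half doors display `hEC : X5.O1.TwoAdicEulerCharRankZero W 0`). THEOREMS ONLY (no definition,
no named fact, no `sorry`); closes no item; nothing booked; no display re-keyed (D-0152); BSD is not proved by any of this.

R. Greenberg, *Iwasawa theory for elliptic curves*, LNM 1716 (1999), Thm. 4.1 (p. 102): for `E/F` good ordinary at every
`v ∣ p` with `Sel_E(F)_p` finite, `f_E(0) ∼ (∏_{v bad} c_v^{(p)}) (∏_{v∣p} |Ẽ_v(f_v)_p|²) |Sel_E(F)_p| / |E(F)_p|²`. The tree has
this as a KERNEL theorem over `ℚ` when `E(ℚ)[p] = 0` (k4-p1 `InputsGreenbergLemma34.constantCoeff_charGenerator_eq_printed`, every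
`p`; this lineage GEN 25 `GreenbergEulerChar.twoAdicEulerCharRankZero_of_noTwoTorsion` at `p = 2`) and otherwise as the named fact
`greenberg_charValue_rankZero` (`p ≠ 2`) / the display `X5.O1.TwoAdicEulerCharRankZero W 0` (`p = 2`). With `E(F)_p ≠ 0` the
printed proof is Lemmas 4.2/4.3 × Lemma 4.7 `|ker g|·|E(F)_p| = |ker r|·|(Sel_∞)_Γ|`; GEN 31 of this lineage proved the «`≥`» half
of Lemma 4.7 for EVERY number field and prime (`TorsionEulerChar.prod_natCard_mul_natCard_endCoinvariants_le`) and Cassels'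
cokernel count (`TorsionEulerChar.finite_and_natCard_cokernel_le`), and ran the assembly at a NON-SPLIT multiplicative prime
(`constantCoeff_mul_sq_eq_nonsplit_rat`). THIS FILE runs the same assembly at a GOOD ORDINARY prime, where every local input
is already a tree theorem: Greenberg's local surjectivity `𝒫_E(ℚ_v)[p^∞] ↠ 𝒫_E(ℚ_{∞,η})[p^∞]^{Γ_v}` (k4-p1
`InputsGreenbergLocalAtP.exists_primary_resOfLe_eq_of_forall_conjH1_eq_all`, p. 108), «DIV» for `H¹(ℚ_∞, E[p^∞])` with ANY
torsion (k4-p1 `InputsGreenbergShaTwoAnyTorsion.forall_exists_conjH1_sub_eq_real`), Lemma 3.4 at the layer `0`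
(`InputsGreenbergLemma34.natCard_localTowerKerPrimary_zero_eq_pow_sq_rat`: `#𝒦_{v,0}[p^∞] = (p^{ord_p #Ẽ(𝔽_p)})²`) and Lemma 3.3
exact away from `p` (b2b `Rank1Residual.Additive.natCard_localTowerKerPrimary_zero_eq_pow_of_isCyclotomic`):

* `constantCoeff_mul_sq_eq_ordinary_rat_of_defect` — `f(0)·#E(ℚ)(p)² = e·#Sel·∏_{v∈S} #𝒦_{v,0}[p^∞]`, `e ∈ ℤ_p ∖ {0}`,
  modulo a receptacle `C` at an auxiliary place `v₀ ∉ S` with `#C ≤ #E(ℚ)(p)` (HYPOTHESIS `hC`);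
* `constantCoeff_mul_sq_eq_ordinary_rat` — the same with `hC` DISCHARGED by Cassels' count (GEN 31 part 5);
* **`constantCoeff_mul_sq_eq_printed_upper`** — in Greenberg's printed currency, EVERY good ordinary `p`, ANY rational
  `p`-torsion: `f(0)·#E(ℚ)(p)² = e · p^{ord_p ∏_ℓ c_ℓ} · (p^{ord_p #Ẽ(𝔽_p)})² · #Sel_{p^∞}(E/ℚ)`, `e ≠ 0`;
* **`charValue_rankZero_upper`** — the same in the EXACT currency of the named fact `greenberg_charValue_rankZero` / of the
  display `X5.O1.TwoAdicEulerCharRankZero W 0` (in `ℚ_p`, with `#Ẽ(𝔽_p)(p)`), the unit `u` replaced by `e ∈ ℤ_p ∖ {0}`: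
  i.e. **`ord_p f_E(0) + 2·ord_p #E(ℚ)(p) ≥ ord_p ∏_ℓ c_ℓ + 2·ord_p #Ẽ(𝔽_p)(p) + ord_p #Sel_{p^∞}(E/ℚ)`** — the direction
  that every UPPER-HALF consumer (`X5.O1.chainUpperAtTwo_of_divisibilityRat` (a) ⟶ `MissingUpperBoundAt W 2`) and every
  rank-`0` `2`-CONVERSE consumer (`f(0) ≠ 0 ⟹ L₀(0) ≠ 0`) uses.

NOT CLAIMED: `e ∈ ℤ_pˣ` (the «`≤`» direction = Greenberg's Lemma 4.6 on `Γ`-invariants: `𝒫^Σ(ℚ_∞)^Γ ⊆ Im(H¹(ℚ_Σ/ℚ_∞, E[p^∞]))`,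
twists `A_s` + Prop. 4.13 — not in the tree), hence no `_holds` for `greenberg_charValue_rankZero` and no two-sided `hEC` at a
curve with rational `2`-torsion; the LOWER-half Eisenstein doors keep their two-sided binder. HONEST FRAMING: kernel-checked
assembly over tree theorems; one half of a printed display; closes no item; no summit statement is proved; the
Birch–Swinnerton-Dyer conjecture is NOT proved by any of this.

References: [GreenbergLNM1716] Thm. 4.1 (p. 102), §3 Lemmas 3.3–3.4 (pp. 86–89), §4 pp. 104–108, Prop. 4.13 (pp. 121–122).
-/

noncomputable section

open scoped Classical NumberField

open NumberField IsDedekindDomain Field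

namespace Summit.BirchSwinnertonDyer.BirchSwinnertonDyer.Theorems.TorsionEulerChar

open Literature.NumberTheory.EllipticCurves Literature.NumberTheory.GaloisRepresentations
  WeierstrassCurve ZpExtension Literature.NumberTheory.EllipticCurves.IwasawaAlgebra
  Literature.NumberTheory.EllipticCurves.IwasawaDual
  Literature.NumberTheory.EllipticCurves.GreenbergVatsal2000 Literature.NumberTheory.EllipticCurves.GreenbergSelmer
  Literature.NumberTheory.EllipticCurves.Rank1Residual Summit.BirchSwinnertonDyer.Rank1Residual.X2

/-! ## §0 Arithmetic helpers (copies of the private helpers of parts 4/6) -/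

/-- A finite additive group all of whose elements are killed by powers of `p` has `p`-power order (`IsPGroup.iff_card`).
[folklore] -/
private theorem exists_natCard_eq_pow (p : ℕ) [Fact p.Prime] {A : Type*} [AddCommGroup A] [Finite A]
    (h : ∀ a : A, ∃ k : ℕ, p ^ k • a = 0) : ∃ n : ℕ, Nat.card A = p ^ n := by
  have hG : IsPGroup p (Multiplicative A) := fun g ↦ by
    obtain ⟨k, hk⟩ := h (Multiplicative.toAdd g)
    exact ⟨k, by rw [← ofAdd_toAdd g, ← ofAdd_nsmul, hk, ofAdd_zero]⟩
  obtain ⟨n, hn⟩ := (IsPGroup.iff_card (p := p) (G := Multiplicative A)).mp hG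
  exact ⟨n, hn⟩

/-- `ord_p` of a product of non-zero naturals is the sum of the `ord_p`. [folklore] -/
private theorem padicValNat_prod {ι : Type*} (p : ℕ) [Fact p.Prime] (s : Finset ι) (f : ι → ℕ)
    (hf : ∀ i ∈ s, f i ≠ 0) : padicValNat p (∏ i ∈ s, f i) = ∑ i ∈ s, padicValNat p (f i) := by
  induction s using Finset.induction_on with
  | empty => simp
  | insert a s ha ih =>
    rw [Finset.prod_insert ha, Finset.sum_insert ha,
      padicValNat.mul (hf a (Finset.mem_insert_self a s))
        (Finset.prod_ne_zero_iff.mpr fun i hi ↦ hf i (Finset.mem_insert_of_mem hi)),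
      ih fun i hi ↦ hf i (Finset.mem_insert_of_mem hi)]

/-- Over `ℚ` a finite place containing the prime `p` is THE place of `p`. [folklore] -/
private theorem eq_of_natCast_mem {p : ℕ} (hp : p.Prime) {v w : HeightOneSpectrum (𝓞 ℚ)}
    (hv : ((p : ℕ) : 𝓞 ℚ) ∈ v.asIdeal) (hw : ((p : ℕ) : 𝓞 ℚ) ∈ w.asIdeal) : v = w :=
  Rat.HeightOneSpectrum.primesEquiv.injective (Subtype.ext
    ((Rat.HeightOneSpectrum.primesEquiv_eq_of_natCast_mem v hp hv).trans
      (Rat.HeightOneSpectrum.primesEquiv_eq_of_natCast_mem w hp hw).symm))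

/-- The local Tamagawa number of `W/ℚ` at a finite place is non-zero (Silverman, *AEC*, Cor. VII.6.2).
[cite: SilvermanAEC2009, VII.6 Cor. 6.2] -/
private theorem localTamagawaNumber_ne_zero_rat (W : WeierstrassCurve ℚ) [W.IsElliptic] (v : HeightOneSpectrum (𝓞 ℚ)) :
    (W.baseChange (v.adicCompletion ℚ)).localTamagawaNumber (v.adicCompletionIntegers ℚ) ≠ 0 := by
  haveI : Fact (Nat.Prime (Rat.HeightOneSpectrum.primesEquiv v : ℕ)) := ⟨(Rat.HeightOneSpectrum.primesEquiv v).2⟩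
  rw [← localTamagawaNumber_padic_eq_holds W v (Rat.HeightOneSpectrum.primesEquiv v : ℕ) rfl]
  exact localTamagawaNumber_padic_ne_zero_holds (Rat.HeightOneSpectrum.primesEquiv v : ℕ) (W.baseChange ℚ_[Rat.HeightOneSpectrum.primesEquiv v])

/-! ## §1 The upper-half Euler characteristic at a good ordinary prime, any rational torsion, modulo Cassels' count -/

/-- **Greenberg's Thm. 4.1 over `ℚ` at a GOOD ORDINARY `p`, ANY rational `p`-torsion — UPPER-HALF direction, modulo Cassels'
count at an auxiliary place.** For `W/ℚ` globally minimal and elliptic, good ordinary at `p` (`GoodOrd W p`), `κ` the cyclotomic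
`ℤ_p`-extension with topological generator `γ`, `Sel_{p^∞}(E/ℚ)` finite, a Pontryagin-dual datum `D` with `char X(E/ℚ_∞) = (f)`,
a finite `S ⊇ {bad} ∪ {p}`, an auxiliary `v₀ ∉ S`, and a receptacle `δ : H¹(Γ_{ℚ_{v₀}}, E)(p) → C` (finite) with kernel
`loc_{v₀}(U)` and `#C ≤ #E(ℚ)(p)` (Cassels' theorem with torsion, Prop. 4.13 — HYPOTHESIS `hC`): `X` is finitely generated
`Λ`-torsion and **`f(0) · #E(ℚ)(p)² = e · #Sel_{p^∞}(E/ℚ) · ∏_{v ∈ S} #𝒦_{v,0}[p^∞]` with `e ∈ ℤ_p`, `e ≠ 0`** (Lemmas 4.2/4.3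
with `#E[p^∞]^{Γ_ℚ} = #E(ℚ)(p)`, times the «≥» half of Lemma 4.7; all orders are powers of `p`). Local surjectivity at every
finite place: k4-p1 LOC_ord at `v ∋ p` + Lemma 3.3's `v ∤ p`; finiteness of `𝒦_{v,0}` at `v ∋ p`: Lemma 3.4 at `n = 0`.
[cite: GreenbergLNM1716, Thm. 4.1 (p. 102), §4 pp. 104–108, Prop. 4.13 (p. 122)] -/
theorem constantCoeff_mul_sq_eq_ordinary_rat_of_defect (p : ℕ) [hp : Fact p.Prime] (W : WeierstrassCurve ℚ)
    [W.IsGloballyMinimal] [W.IsElliptic] (hgo : GoodOrd W p) (κ : ZpExtension ℚ p) (hκ : κ.IsCyclotomic)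
    {γ : absoluteGaloisGroup ℚ} (hγ : κ.IsTopGenerator γ) (D : W.SelmerDualData κ γ) [Finite (W.selmerGroupPInfty p)]
    (S : Finset (HeightOneSpectrum (𝓞 ℚ))) (hS : ∀ v ∉ S, ((p : ℕ) : 𝓞 ℚ) ∉ v.asIdeal ∧ W.HasGoodReductionAt v)
    (v₀ : HeightOneSpectrum (𝓞 ℚ)) (hv₀ : v₀ ∉ S)
    {C : Type*} [AddCommGroup C] [Finite C]
    (δ : AddCommGroup.primaryComponent
      (discreteH1 (localSubgroup (⊤ : Subgroup (absoluteGaloisGroup ℚ)) (v₀.adicCompletion ℚ))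
        (localPoints W (v₀.adicCompletion ℚ))) p →+ C)
    (hδ : ∀ z : AddCommGroup.primaryComponent
        (discreteH1 (localSubgroup (⊤ : Subgroup (absoluteGaloisGroup ℚ)) (v₀.adicCompletion ℚ))
          (localPoints W (v₀.adicCompletion ℚ))) p, δ z = 0 ↔
      (z : discreteH1 (localSubgroup (⊤ : Subgroup (absoluteGaloisGroup ℚ)) (v₀.adicCompletion ℚ))
        (localPoints W (v₀.adicCompletion ℚ))) ∈
        AddSubgroup.map (W.localResOver p ⊤ (v₀.adicCompletion ℚ))
          (unramifiedOutside (⊤ : Subgroup (absoluteGaloisGroup ℚ)) (W.geomPrimaryTorsion p) p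
              ((↑S : Set (HeightOneSpectrum (𝓞 ℚ))) ∪ {v₀}) ⊓
            (⨅ v ∈ S, W.localKerOver p ⊤ (v.adicCompletion ℚ)) ⊓
            (⨅ w : InfinitePlace ℚ, W.localKerOver p ⊤ w.Completion)))
    (hC : Nat.card C ≤ Nat.card (AddCommGroup.primaryComponent W.toAffine.Point p))
    (f : IwasawaAlgebra p) (hf : Module.charIdeal (IwasawaAlgebra p) D.X = Ideal.span {f}) :
    Module.Finite (IwasawaAlgebra p) D.X ∧ Module.IsTorsion (IwasawaAlgebra p) D.X ∧
      ∃ e : ℤ_[p], e ≠ 0 ∧ PowerSeries.constantCoeff f *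
          (Nat.card (AddCommGroup.primaryComponent W.toAffine.Point p) : ℤ_[p]) ^ 2 =
        e * Nat.card (W.selmerGroupPInfty p) * ∏ v ∈ S, Nat.card (W.localTowerKerPrimary κ (v.adicCompletion ℚ) 0) := by
  -- adapted from `constantCoeff_mul_sq_eq_nonsplit_rat_of_defect` (GEN 31 part 4) with the multiplicative local inputs
  -- replaced by Lemma 3.4 at the layer `0` and LOC_ord
  have hprime : p.Prime := hp.out
  have hord : IsOrdinaryAt W p := hgo
  -- finiteness of the local tower kernels on `S` and of `ker g₀`
  have hTp : ∀ v : HeightOneSpectrum (𝓞 ℚ), ((p : ℕ) : 𝓞 ℚ) ∈ v.asIdeal →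
      Finite (W.localTowerKerPrimary κ (v.adicCompletion ℚ) 0) := fun v hpv ↦
    (InputsGreenbergLemma34.lemma34_rat_zero W p hord κ hκ v hpv).1
  have hT : ∀ v ∈ S, Finite (W.localTowerKerPrimary κ (v.adicCompletion ℚ) 0) := fun v _ ↦ by
    by_cases hpv : ((p : ℕ) : 𝓞 ℚ) ∈ v.asIdeal
    · exact hTp v hpv
    · exact W.finite_localTowerKerPrimary_zero_of_not_mem κ hpv
  have hg : Finite (W.KerG κ 0) := W.finite_kerG_zero_of_finite_localTowerKerPrimary_dvd κ hTp
  -- Lemmas 4.2/4.3: `f(0) · #(Sel_∞)_γ · #E[p^∞]^{Γ_ℚ} = u · #Sel · #(A₀/Sel₀)`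
  obtain ⟨hFG, hX, -, hCofin, -, u, hu⟩ :=
    D.constantCoeff_charGenerator_mul_natCard_of_finite_selmerGroup_rat W hγ ‹_› hg f hf
  haveI := hCofin
  refine ⟨hFG, hX, ?_⟩
  -- Lemma 4.7, the «≥» half: `∏#𝒦 · #(Sel_∞)_γ ≤ #(A₀/Sel₀) · #C`
  have hineq := prod_natCard_mul_natCard_endCoinvariants_le W p κ hκ hγ ‹_›
    (InputsGreenbergShaTwoAnyTorsion.forall_exists_conjH1_sub_eq_real W p κ hγ)
    (fun v c hc hfix ↦ InputsGreenbergLocalAtP.exists_primary_resOfLe_eq_of_forall_conjH1_eq_all W hgo κ hκ v c hc hfix)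
    S hS v₀ hv₀ δ hδ hT
  -- the four orders are powers of `p`
  rw [natCard_fixedPoints_geomPrimaryTorsion_eq W p] at hu
  have hdec : (fun a b : ℚ => Classical.propDecidable (a = b)) = instDecidableEqRat := Subsingleton.elim _ _
  rw [hdec] at hu
  obtain ⟨hEfin, -⟩ := (W.finite_selmerGroupPInfty_iff p).mp ‹_›
  haveI := hEfin
  obtain ⟨a, ha⟩ : ∃ a : ℕ, ∏ v ∈ S, Nat.card (W.localTowerKerPrimary κ (v.adicCompletion ℚ) 0) = p ^ a := by
    have hv : ∀ v ∈ S, ∃ a : ℕ, Nat.card (W.localTowerKerPrimary κ (v.adicCompletion ℚ) 0) = p ^ a := fun v hv ↦ by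
      haveI := hT v hv
      exact exists_natCard_eq_pow p fun x ↦ by
        obtain ⟨-, k, hk⟩ := (W.mem_localTowerKerPrimary_iff κ _ 0 _).mp x.2
        exact ⟨k, Subtype.ext (by rw [AddSubgroupClass.coe_nsmul, hk, ZeroMemClass.coe_zero])⟩
    choose! e he using hv
    exact ⟨∑ v ∈ S, e v, by rw [← Finset.prod_pow_eq_pow_sum]; exact Finset.prod_congr rfl he⟩
  obtain ⟨b, hb⟩ : ∃ b : ℕ, Nat.card (EndCoinvariants (W.conjSelmerInfty κ γ - 1)) = p ^ b :=
    exists_natCard_eq_pow p fun x ↦ by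
      induction x using QuotientAddGroup.induction_on with
      | H s =>
        obtain ⟨k, hk⟩ := W.exists_pow_smul_subgroupH1_ker_eq_zero κ (s : W.subgroupH1 p κ.kerSubgroup)
        refine ⟨k, ?_⟩
        have hs : p ^ k • s = 0 := Subtype.ext (by rw [AddSubgroupClass.coe_nsmul, hk, ZeroMemClass.coe_zero])
        rw [← QuotientAddGroup.mk_nsmul, hs, QuotientAddGroup.mk_zero]
  obtain ⟨c, hc⟩ : ∃ c : ℕ, Nat.card (W.KerG κ 0) = p ^ c :=
    exists_natCard_eq_pow p fun x ↦ by
      induction x using QuotientAddGroup.induction_on with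
      | H y =>
        obtain ⟨k, hk⟩ := W.exists_pow_smul_subgroupH1_layer_eq_zero κ 0 (y : W.subgroupH1 p (κ.layerSubgroup 0))
        refine ⟨k, ?_⟩
        have hy : p ^ k • y = 0 := Subtype.ext (by rw [AddSubgroupClass.coe_nsmul, hk, ZeroMemClass.coe_zero])
        rw [← QuotientAddGroup.mk_nsmul, hy, QuotientAddGroup.mk_zero]
  obtain ⟨d, hd⟩ : ∃ d : ℕ, Nat.card (AddCommGroup.primaryComponent W.toAffine.Point p) = p ^ d :=
    exists_natCard_eq_pow p fun P ↦ by
      obtain ⟨k, hk⟩ := (AddCommGroup.mem_primaryComponent).mp P.2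
      exact ⟨k, Subtype.ext (by rw [AddSubgroupClass.coe_nsmul, hk, ZeroMemClass.coe_zero])⟩
  -- `a + b ≤ c + d`
  have hle : a + b ≤ c + d := by
    have h := hineq.trans (Nat.mul_le_mul_left _ hC)
    rw [ha, hb, hc, hd, ← pow_add, ← pow_add] at h
    exact (Nat.pow_le_pow_iff_right hprime.one_lt).mp h
  obtain ⟨m, hm⟩ := Nat.exists_eq_add_of_le hle
  -- multiply out in `ℤ_p`
  rw [hb, hd, hc] at hu
  push_cast at hu
  refine ⟨u * (p : ℤ_[p]) ^ m, mul_ne_zero (Units.ne_zero u) (pow_ne_zero _ (by exact_mod_cast hprime.ne_zero)), ?_⟩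
  rw [ha, hd]
  push_cast
  have hb0 : ((p : ℤ_[p]) ^ b) ≠ 0 := pow_ne_zero _ (by exact_mod_cast hprime.ne_zero)
  have hpow : ((p : ℤ_[p]) ^ c) * (p : ℤ_[p]) ^ d = (p : ℤ_[p]) ^ a * (p : ℤ_[p]) ^ b * (p : ℤ_[p]) ^ m := by
    rw [← pow_add, ← pow_add, ← pow_add, hm]
  refine mul_right_cancel₀ hb0 ?_
  calc PowerSeries.constantCoeff f * ((p : ℤ_[p]) ^ d) ^ 2 * (p : ℤ_[p]) ^ b
      = (PowerSeries.constantCoeff f * (p : ℤ_[p]) ^ b * (p : ℤ_[p]) ^ d) * (p : ℤ_[p]) ^ d := by ring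
    _ = (u : ℤ_[p]) * Nat.card (W.selmerGroupPInfty p) * (p : ℤ_[p]) ^ c * (p : ℤ_[p]) ^ d := by rw [hu]
    _ = (u : ℤ_[p]) * Nat.card (W.selmerGroupPInfty p) * ((p : ℤ_[p]) ^ c * (p : ℤ_[p]) ^ d) := by ring
    _ = (u : ℤ_[p]) * Nat.card (W.selmerGroupPInfty p) * ((p : ℤ_[p]) ^ a * (p : ℤ_[p]) ^ b * (p : ℤ_[p]) ^ m) := by
          rw [hpow]
    _ = (u : ℤ_[p]) * (p : ℤ_[p]) ^ m * Nat.card (W.selmerGroupPInfty p) * (p : ℤ_[p]) ^ a * (p : ℤ_[p]) ^ b := by ring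

/-! ## §2 Cassels' count discharges the receptacle -/

/-- **THE UPPER-HALF EULER-CHARACTERISTIC DISPLAY AT A GOOD ORDINARY `p` OVER `ℚ`, NO HYPOTHESIS ON `E(ℚ)[p]`.** For `W/ℚ`
globally minimal elliptic, good ordinary at `p`, `κ` cyclotomic with topological generator `γ`, `D` a dual datum with
`char X = (f)`, `Sel_{p^∞}(E/ℚ)` finite, and `S ⊇ {bad} ∪ {p}` a finite set off which `E` is good and `v ∤ p`, `v₀ ∉ S`:
`X` is finitely generated `Λ`-torsion and **`f(0) · #E(ℚ)(p)² = e · #Sel_{p^∞}(E/ℚ) · ∏_{v ∈ S} #𝒦_{v,0}[p^∞]` with `e ≠ 0`**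
— §1 with Cassels' cokernel at `v₀` (GEN 31 part 5, `finite_and_natCard_cokernel_le`) as the receptacle.
[cite: GreenbergLNM1716, Thm. 4.1 (p. 102), §4 pp. 104–108, Prop. 4.13 (p. 122)] -/
theorem constantCoeff_mul_sq_eq_ordinary_rat (p : ℕ) [hp : Fact p.Prime] (W : WeierstrassCurve ℚ)
    [W.IsGloballyMinimal] [W.IsElliptic] (hgo : GoodOrd W p) (κ : ZpExtension ℚ p) (hκ : κ.IsCyclotomic)
    {γ : absoluteGaloisGroup ℚ} (hγ : κ.IsTopGenerator γ) (D : W.SelmerDualData κ γ) [Finite (W.selmerGroupPInfty p)]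
    (S : Finset (HeightOneSpectrum (𝓞 ℚ))) (hS : ∀ v ∉ S, ((p : ℕ) : 𝓞 ℚ) ∉ v.asIdeal ∧ W.HasGoodReductionAt v)
    (v₀ : HeightOneSpectrum (𝓞 ℚ)) (hv₀ : v₀ ∉ S)
    (f : IwasawaAlgebra p) (hf : Module.charIdeal (IwasawaAlgebra p) D.X = Ideal.span {f}) :
    Module.Finite (IwasawaAlgebra p) D.X ∧ Module.IsTorsion (IwasawaAlgebra p) D.X ∧
      ∃ e : ℤ_[p], e ≠ 0 ∧ PowerSeries.constantCoeff f *
          (Nat.card (AddCommGroup.primaryComponent W.toAffine.Point p) : ℤ_[p]) ^ 2 =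
        e * Nat.card (W.selmerGroupPInfty p) * ∏ v ∈ S, Nat.card (W.localTowerKerPrimary κ (v.adicCompletion ℚ) 0) := by
  -- adapted from `constantCoeff_mul_sq_eq_nonsplit_rat` (GEN 31 part 6)
  classical
  let Pv := discreteH1 (localSubgroup (⊤ : Subgroup (absoluteGaloisGroup ℚ)) (v₀.adicCompletion ℚ))
    (localPoints W (v₀.adicCompletion ℚ))
  let P₀ : AddSubgroup Pv := AddCommGroup.primaryComponent Pv p
  let L : AddSubgroup Pv := AddSubgroup.map (W.localResOver p ⊤ (v₀.adicCompletion ℚ))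
    (unramifiedOutside (⊤ : Subgroup (absoluteGaloisGroup ℚ)) (W.geomPrimaryTorsion p) p
        ((↑S : Set (HeightOneSpectrum (𝓞 ℚ))) ∪ {v₀}) ⊓
      (⨅ v ∈ S, W.localKerOver p ⊤ (v.adicCompletion ℚ)) ⊓
      (⨅ w : InfinitePlace ℚ, W.localKerOver p ⊤ w.Completion))
  obtain ⟨hfin, hC⟩ := finite_and_natCard_cokernel_le W p S hS v₀ hv₀
  haveI : Finite (P₀ ⧸ L.addSubgroupOf P₀) := hfin
  have hdec : (fun a b : ℚ => Classical.propDecidable (a = b)) = instDecidableEqRat := Subsingleton.elim _ _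
  rw [hdec] at hC
  exact constantCoeff_mul_sq_eq_ordinary_rat_of_defect p W hgo κ hκ hγ D S hS v₀ hv₀
    (QuotientAddGroup.mk' (L.addSubgroupOf P₀)) (fun z ↦ by
      rw [QuotientAddGroup.mk'_apply, QuotientAddGroup.eq_zero_iff, AddSubgroup.mem_addSubgroupOf]) hC f hf

/-! ## §3 The printed currency: `∏_{v ∈ S} #𝒦_{v,0}[p^∞] = p^{ord_p ∏_ℓ c_ℓ} · (p^{ord_p #Ẽ(𝔽_p)})²` -/

/-- **Greenberg's Thm. 4.1 over `ℚ`, printed shape, UPPER-HALF direction, EVERY good ordinary `p`, ANY rational `p`-torsion:**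
for `W/ℚ` globally minimal and elliptic with `GoodOrd W p`, `κ` cyclotomic with topological generator `γ`, `D` a dual datum with
`char X = (f)` and `Sel_{p^∞}(E/ℚ)` finite: `X` is finitely generated `Λ`-torsion and
**`f(0) · #E(ℚ)(p)² = e · p^{ord_p ∏_ℓ c_ℓ} · (p^{ord_p #Ẽ(𝔽_p)})² · #Sel_{p^∞}(E/ℚ)`** for some **non-zero** `e ∈ ℤ_p`
(`#Ẽ(𝔽_p) = W.reductionPointCount p`). §2 with `S` = bad ∪ {p} (`exists_finset_place`); the local orders are Lemma 3.4 at
`n = 0` (`InputsGreenbergLemma34.natCard_localTowerKerPrimary_zero_eq_pow_sq_rat`) at `v ∋ p` and Lemma 3.3 exact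
(`Rank1Residual.Additive.natCard_localTowerKerPrimary_zero_eq_pow_of_isCyclotomic`) at `v ∤ p`, summed with
`∏_ℓ c_ℓ = ∏_{v ∈ S} c_v` (`c_v = 1` at good `v`). `e ∈ ℤ_pˣ` (the print display, `greenberg_charValue_rankZero`) is NOT claimed.
[cite: GreenbergLNM1716, Thm. 4.1 (p. 102), §3 Lemmas 3.3–3.4 (pp. 86–89), §4 pp. 104–108] -/
theorem constantCoeff_mul_sq_eq_printed_upper (p : ℕ) [hp : Fact p.Prime] (W : WeierstrassCurve ℚ)
    [W.IsGloballyMinimal] [W.IsElliptic] (hgo : GoodOrd W p) (κ : ZpExtension ℚ p) (hκ : κ.IsCyclotomic)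
    {γ : absoluteGaloisGroup ℚ} (hγ : κ.IsTopGenerator γ) (D : W.SelmerDualData κ γ) [Finite (W.selmerGroupPInfty p)]
    (f : IwasawaAlgebra p) (hf : Module.charIdeal (IwasawaAlgebra p) D.X = Ideal.span {f}) :
    Module.Finite (IwasawaAlgebra p) D.X ∧ Module.IsTorsion (IwasawaAlgebra p) D.X ∧
      ∃ e : ℤ_[p], e ≠ 0 ∧ PowerSeries.constantCoeff f *
          (Nat.card (AddCommGroup.primaryComponent W.toAffine.Point p) : ℤ_[p]) ^ 2 =
        e * (p ^ padicValNat p W.tamagawaProduct : ℕ) * ((p ^ padicValNat p (W.reductionPointCount p)) ^ 2 : ℕ) *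
          Nat.card (W.selmerGroupPInfty p) := by
  -- adapted from `constantCoeff_mul_sq_eq_two_nonsplit_of_defect` (GEN 31 part 4, §2)
  obtain ⟨S, v₀, hS, hv₀⟩ := exists_finset_place W p
  obtain ⟨hFG, hX, e, he, hu⟩ := constantCoeff_mul_sq_eq_ordinary_rat p W hgo κ hκ hγ D S hS v₀ hv₀ f hf
  refine ⟨hFG, hX, e, he, ?_⟩
  rw [hu, mul_assoc, mul_assoc, mul_assoc, mul_comm (Nat.card (W.selmerGroupPInfty p) : ℤ_[p])]
  congr 1
  have hprime : p.Prime := hp.out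
  -- the place `v_p` of `p` lies in `S`
  set vp : HeightOneSpectrum (𝓞 ℚ) := Rat.HeightOneSpectrum.primesEquiv.symm ⟨p, hprime⟩ with hvpdef
  have hvp : ((p : ℕ) : 𝓞 ℚ) ∈ vp.asIdeal := by
    have h := Rat.HeightOneSpectrum.natCast_natGenerator_mem vp
    have hgen : Rat.HeightOneSpectrum.natGenerator vp = p := by
      change ((Rat.HeightOneSpectrum.primesEquiv vp : Nat.Primes) : ℕ) = p
      rw [hvpdef, Equiv.apply_symm_apply]
    rwa [hgen] at h
  have hvpS : vp ∈ S := by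
    by_contra h
    exact (hS vp h).1 hvp
  have hgoodS : ∀ v ∉ S, W.HasGoodReductionAt v := fun v hv ↦ (hS v hv).2
  -- evaluate the local orders
  let c : HeightOneSpectrum (𝓞 ℚ) → ℕ := fun v ↦
    (W.baseChange (v.adicCompletion ℚ)).localTamagawaNumber (v.adicCompletionIntegers ℚ)
  have hsplit := Finset.mul_prod_erase S (fun v ↦ Nat.card (W.localTowerKerPrimary κ (v.adicCompletion ℚ) 0)) hvpS
  have hne : ∀ v ∈ S.erase vp, ((p : ℕ) : 𝓞 ℚ) ∉ v.asIdeal := fun v hv hpv ↦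
    (Finset.mem_erase.mp hv).1 (eq_of_natCast_mem hprime hpv hvp)
  have herase : ∏ v ∈ S.erase vp, Nat.card (W.localTowerKerPrimary κ (v.adicCompletion ℚ) 0) =
      p ^ ∑ v ∈ S.erase vp, padicValNat p (c v) := by
    rw [← Finset.prod_pow_eq_pow_sum]
    refine Finset.prod_congr rfl fun v hv ↦ ?_
    exact Rank1Residual.Additive.natCard_localTowerKerPrimary_zero_eq_pow_of_isCyclotomic W hκ (hne v hv)
  -- `∑_{v ∈ S} ord_p c_v = ord_p ∏_ℓ c_ℓ`, and `c_{v_p} = 1` (good reduction at `p`)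
  have htam : W.tamagawaProduct = ∏ v ∈ S, c v := by
    have hsupp : (Function.mulSupport c) ⊆ (S : Set (HeightOneSpectrum (𝓞 ℚ))) := by
      intro v hv
      by_contra hvS
      exact hv (W.localTamagawaNumber_eq_one_of_hasGoodReductionAt_holds v (hgoodS v hvS))
    change ∏ᶠ v, c v = _
    rw [finprod_eq_prod_of_mulSupport_subset c hsupp]
  have hsum : padicValNat p (c vp) + ∑ v ∈ S.erase vp, padicValNat p (c v) = padicValNat p W.tamagawaProduct := by
    rw [htam, padicValNat_prod p _ c fun v _ ↦ localTamagawaNumber_ne_zero_rat W v, ← Finset.add_sum_erase S _ hvpS]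
  have hcvp : c vp = 1 := by
    have hgood : W.HasGoodReductionAt vp := W.hasGoodReductionAt_of_hasGoodReductionAtPrime vp hvp hgo.1
    exact W.localTamagawaNumber_eq_one_of_hasGoodReductionAt_holds vp hgood
  have hsum' : ∑ v ∈ S.erase vp, padicValNat p (c v) = padicValNat p W.tamagawaProduct := by
    rw [← hsum, hcvp, padicValNat_one_right, zero_add]
  have hcp : Nat.card (W.localTowerKerPrimary κ (vp.adicCompletion ℚ) 0) =
      (p ^ padicValNat p (W.reductionPointCount p)) ^ 2 :=
    InputsGreenbergLemma34.natCard_localTowerKerPrimary_zero_eq_pow_sq_rat W hgo κ hκ vp hvp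
  rw [← hsplit, herase, hcp, hsum']
  push_cast
  ring

/-- **The same in the EXACT currency of the named fact `greenberg_charValue_rankZero` (and, at `p = 2`, of the display
`X5.O1.TwoAdicEulerCharRankZero W 0`), with the unit replaced by a NON-ZERO `p`-adic integer:** for `W/ℚ` globally minimal and
elliptic, `GoodOrd W p`, `κ` cyclotomic with topological generator `γ`, `D` a dual datum, `char X = (fE)`, `Sel_{p^∞}(E/ℚ)` finite:
`∃ e ∈ ℤ_p ∖ {0}`, **`fE(0) · #E(ℚ)(p)² = e · p^{ord_p ∏_ℓ c_ℓ} · #Ẽ(𝔽_p)(p)² · #Sel_{p^∞}(E/ℚ)`** in `ℚ_p` — i.e.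
`ord_p fE(0) + 2·ord_p #E(ℚ)(p) ≥ ord_p ∏_ℓ c_ℓ + 2·ord_p #Ẽ(𝔽_p)(p) + ord_p #Sel`. NO hypothesis on `E(ℚ)[p]`, no `p ≠ 2`.
(`#Ẽ(𝔽_p)(p) = p^{ord_p #Ẽ(𝔽_p)}`: k4-p1 `InputsGreenbergCharValue.natCard_primaryComponent_reduction_eq_pow`.)
[cite: GreenbergLNM1716, Thm. 4.1 (p. 102), §4 pp. 104–108] -/
theorem charValue_rankZero_upper (p : ℕ) [hp : Fact p.Prime] (W : WeierstrassCurve ℚ)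
    [W.IsGloballyMinimal] [W.IsElliptic] (hgo : GoodOrd W p) (κ : ZpExtension ℚ p) (hκ : κ.IsCyclotomic)
    {γ : absoluteGaloisGroup ℚ} (hγ : κ.IsTopGenerator γ) (D : W.SelmerDualData κ γ) [Finite (W.selmerGroupPInfty p)]
    (fE : IwasawaAlgebra p) (hf : D.charIdeal = Ideal.span {fE}) :
    ∃ e : ℤ_[p], e ≠ 0 ∧
      ((PowerSeries.constantCoeff fE : ℤ_[p]) : ℚ_[p]) *
          (Nat.card (AddCommGroup.primaryComponent W.toAffine.Point p) : ℚ_[p]) ^ 2 =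
        ((e : ℤ_[p]) : ℚ_[p]) * (p : ℚ_[p]) ^ (padicValNat p W.tamagawaProduct) *
          (Nat.card (AddCommGroup.primaryComponent
            ((integralModelInt W).map (Int.castRingHom (ZMod p))).toAffine.Point p) : ℚ_[p]) ^ 2 *
          (Nat.card (W.selmerGroupPInfty p) : ℚ_[p]) := by
  obtain ⟨-, -, e, he, hu⟩ := constantCoeff_mul_sq_eq_printed_upper p W hgo κ hκ hγ D fE hf
  refine ⟨e, he, ?_⟩
  rw [InputsGreenbergCharValue.natCard_primaryComponent_reduction_eq_pow W p]
  have h := congrArg ((↑) : ℤ_[p] → ℚ_[p]) hu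
  push_cast at h ⊢
  rw [h]

/-- **`p = 2`, the upper half of `X5.O1.TwoAdicEulerCharRankZero W 0` for EVERY globally minimal elliptic `W/ℚ` good ordinary
at `2` — rational `2`-torsion ALLOWED:** `∃ e ∈ ℤ₂ ∖ {0}`, `fE(0)·#E(ℚ)(2)² = e·2^{ord₂ ∏_ℓ c_ℓ}·#Ẽ(𝔽₂)(2)²·#Sel_{2^∞}(E/ℚ)` in
`ℚ₂`. The two-sided version (`e ∈ ℤ₂ˣ`) is GEN 25's `GreenbergEulerChar.twoAdicEulerCharRankZero_of_noTwoTorsion` on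
{`E(ℚ)[2] = 0`} and needs Lemma 4.6^Γ otherwise (NOT claimed). [cite: GreenbergLNM1716, Thm. 4.1 (p. 102), §4 pp. 104–108] -/
theorem charValue_rankZero_upper_two (W : WeierstrassCurve ℚ) [W.IsGloballyMinimal] [W.IsElliptic] (hgo : GoodOrd W 2)
    (κ : ZpExtension ℚ 2) (hκ : κ.IsCyclotomic) {γ : absoluteGaloisGroup ℚ} (hγ : κ.IsTopGenerator γ)
    (D : W.SelmerDualData κ γ) [Finite (W.selmerGroupPInfty 2)]
    (fE : IwasawaAlgebra 2) (hf : D.charIdeal = Ideal.span {fE}) :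
    ∃ e : ℤ_[2], e ≠ 0 ∧
      ((PowerSeries.constantCoeff fE : ℤ_[2]) : ℚ_[2]) *
          (Nat.card (AddCommGroup.primaryComponent W.toAffine.Point 2) : ℚ_[2]) ^ 2 =
        ((e : ℤ_[2]) : ℚ_[2]) * (2 : ℚ_[2]) ^ (padicValNat 2 W.tamagawaProduct) *
          (Nat.card (AddCommGroup.primaryComponent
            ((integralModelInt W).map (Int.castRingHom (ZMod 2))).toAffine.Point 2) : ℚ_[2]) ^ 2 *
          (Nat.card (W.selmerGroupPInfty 2) : ℚ_[2]) := by
  have h := charValue_rankZero_upper 2 W hgo κ hκ hγ D fE hf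
  rwa [Nat.cast_ofNat] at h

end Summit.BirchSwinnertonDyer.BirchSwinnertonDyer.Theorems.TorsionEulerChar

end
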